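import Summits.Ventures.PercRepro.GenQShareTablesT
import Summits.Ventures.PercRepro.GenQCovering
import Summits.Ventures.PercRepro.GenQOpenLayersCoreSmall

/-!
# PercRepro — THE `t = 1` WINDOWS OF THE DIAGONAL ROWS `q = 6 … 11`, IN THE KERNEL (night-4, gen 3; sheet §52)

At type `1` every spanning set but `G` demands, so a basis `B₀` of `G` has the deficit `1 − Φ_q = −1/(q + 1)` and every
spanning non-basis is positive; the charging form `Jq_nonneg_of_chargeT` with the demanding-endpoint tables of
`GenQShareTablesT.lean` (singletons `≥ s₃ = ((q + 1)/(q − 1) − Φ_q)/3`, pairs `≥ p₅ = ((q + 1)/(q − 2) − Φ_q)/10`)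
carries the window `q + 2 ≤ g`, `(g − q)(q + 3) + 1 < q²` for `q = 6, 7, 8, 9` (`jq_one_nonneg_of_tables`; at
`g = q + 2`: `2 s₃ = 6/35, 5/36, 22/189, 1/10 ≥ 1/7, 1/8, 1/9, 1/10`), and with the coloop-free covering for
`q = 10, 11` (`jq_one_nonneg_of_tables_cover`: at `g = q + 2` the two circuits have `≥ q + 2` points together, so
one has `≥ 6` resp. `≥ 7` points and charges `≥ 49/396` resp. `≥ 11/84` alone).
-/

namespace PercRepro.GenQ

open Finset ThmH PerFlat SixFour ThmN NightThree

variable {α : Type*} [DecidableEq α] {M : Matroid α} [M.Finite]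

/-- A basis has `wT ≥ −1/(q + 1)` at type `1`. -/
theorem wT_one_basis_ge {G B₀ : Finset α} {q : ℕ} (hG : G ⊆ gr M) (hB : B₀ ∈ basesOf M G q) :
    -(1 / ((q : ℚ) + 1)) ≤ wT M G B₀ q 1 := by
  obtain ⟨hBG, hr, _⟩ := mem_basesOf.1 hB
  unfold wT wInf
  have hm : mTr M B₀ ≤ q := mTr_le_of_eRk_eq (hBG.trans hG) hr
  have hm' : (mTr M B₀ : ℚ) ≤ q := by exact_mod_cast hm
  have hq0 : (0 : ℚ) ≤ q := Nat.cast_nonneg q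
  have hwinf : (1 : ℚ) / ((q : ℚ) + 1) ≤ 1 / (1 + (mTr M B₀ : ℚ)) :=
    one_div_le_one_div_of_le (by positivity) (by linarith)
  have hd := dem_le_one (M := M) G B₀ 1
  have hphi : (0 : ℚ) ≤ ((q : ℚ) + 2) / ((q : ℚ) + 1) := by positivity
  have h1 : ((q : ℚ) + 2) / ((q : ℚ) + 1) = 1 + 1 / ((q : ℚ) + 1) := by
    field_simp
    ring
  have h2 : ((q : ℚ) + 1) * (1 / ((q : ℚ) + 1)) = 1 := by
    field_simp
  push_cast
  nlinarith [mul_le_mul_of_nonneg_left hwinf (by linarith : (0 : ℚ) ≤ (q : ℚ) + 2 - 1),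
    mul_le_mul_of_nonneg_left hd hphi]

/-- **The type-`1` balance from uniform tables**: with `s₃ ≤ ((q + 1)/(q + 2 − c) − Φ_q)/c` for every `c ∈ [3, q + 1]`
and `p₅ ≤ ((q + 1)/(q + 3 − u) − Φ_q)/C(u, 2)` for every `u ∈ [5, q + 2]`, the balance holds on `G` as soon as
`1/(q + 1) ≤ k·s₃ + C(k, 2)·p₅` for `k = #G − q ≥ 2`. -/
theorem jq_one_nonneg_of_tables (hs : Simple M) (hline : ∀ L ∈ flatsQ M 2, L.card ≤ 3) {G : Finset α} {q : ℕ}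
    (hq : 2 ≤ q) (hG : G ∈ flatsQ M q) (s₃ p₅ : ℚ)
    (hs₃ : ∀ c : ℕ, 3 ≤ c → c ≤ q + 1 →
      s₃ ≤ (((q : ℚ) + 2 - (1 : ℕ)) / ((q : ℚ) + 2 - c) - ((q : ℚ) + 2) / ((q : ℚ) + 1)) / c)
    (hp₅ : ∀ u : ℕ, 5 ≤ u → u ≤ q + 2 →
      p₅ ≤ (((q : ℚ) + 2 - (1 : ℕ)) / ((q : ℚ) + 3 - u) - ((q : ℚ) + 2) / ((q : ℚ) + 1)) / (u.choose 2 : ℕ))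
    (harith : 1 / ((q : ℚ) + 1) ≤ ((G.card - q : ℕ) : ℚ) * s₃ + (((G.card - q).choose 2 : ℕ) : ℚ) * p₅) :
    0 ≤ Jq M G q 1 := by
  have hGg : G ⊆ gr M := (mem_flatsQ.1 hG).1
  have hrG : M.eRk (G : Set α) = (q : ℕ∞) := (mem_flatsQ.1 hG).2.2
  apply Jq_nonneg_of_chargeT
  intro B₀ hB
  obtain ⟨hBG, hr, hc⟩ := mem_basesOf.1 hB
  have hkc : (G \ B₀).card = G.card - q := by rw [Finset.card_sdiff_of_subset hBG, hc]
  have hw := wT_one_basis_ge hGg hB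
  have hne : B₀.Nonempty := Finset.card_pos.1 (by omega)
  have hσ : ∀ x ∈ G \ B₀, s₃ ≤ wT M G (insert x B₀) q 1 / nb M G (insert x B₀) q := by
    intro x hx
    have hc3 := three_le_card_fc hs (hBG.trans hGg) (hGg (Finset.mem_sdiff.1 hx).1) (indep_of_mem_basesOf hB)
      (mem_closure_of_mem_basesOf hGg hrG hB (Finset.mem_sdiff.1 hx).1) (Finset.mem_sdiff.1 hx).2 hne
    have hcq : (fc M x B₀).card ≤ q + 1 := by
      have := card_fc_le (M := M) x B₀
      omega
    exact single_boundT hs hGg hrG hB hq (by norm_num) hx hc3 hcq hs₃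
  have hτ : ∀ P ∈ (G \ B₀).powersetCard 2, p₅ ≤ wT M G (B₀ ∪ P) q 1 / nb M G (B₀ ∪ P) q := by
    intro P hP
    refine pair_boundT hs hGg hrG hB hq (by norm_num) hP (u₀ := 5) ?_ hp₅
    intro x hx y hy hxy
    have hPsub := (Finset.mem_powersetCard.1 hP).1
    exact five_le_card_union_fc hs hline hGg hrG hB hq (Finset.mem_sdiff.1 (hPsub hx)).1
      (Finset.mem_sdiff.1 (hPsub hx)).2 (Finset.mem_sdiff.1 (hPsub hy)).1 (Finset.mem_sdiff.1 (hPsub hy)).2 hxy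
  have h := chargeT_ge_of_bounds_fn hs hGg hrG hB hq (by norm_num) (fun _ => s₃) (fun _ => p₅) hσ hτ
  rw [Finset.sum_const, Finset.sum_const, Finset.card_powersetCard, nsmul_eq_mul, nsmul_eq_mul, hkc] at h
  linarith

/-- **The type-`1` balance from uniform tables and the coloop-free covering at `g = q + 2`**: as above, with the
extra bound `s_big ≤ ((q + 1)/(q + 2 − c) − Φ_q)/c` for `c ∈ [c*, q + 1]` where `2c* ≤ q + 3` — at `g = q + 2` the two
circuits have `≥ q + 2` points together, so one of them has `≥ c*` points. -/
theorem jq_one_nonneg_of_tables_cover (hs : Simple M) (hline : ∀ L ∈ flatsQ M 2, L.card ≤ 3) {G : Finset α} {q : ℕ}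
    (hq : 2 ≤ q) (hG : G ∈ flatsQ M q) (hfree : mTr M G = 0) (hk : q + 2 ≤ G.card) (s₃ p₅ s_big : ℚ)
    (c_star : ℕ) (hc_star : 2 * c_star ≤ q + 3) (hs₃p : s₃ ≤ s_big) (hp₅0 : 0 ≤ p₅)
    (hs₃ : ∀ c : ℕ, 3 ≤ c → c ≤ q + 1 →
      s₃ ≤ (((q : ℚ) + 2 - (1 : ℕ)) / ((q : ℚ) + 2 - c) - ((q : ℚ) + 2) / ((q : ℚ) + 1)) / c)
    (hsbig : ∀ c : ℕ, c_star ≤ c → c ≤ q + 1 →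
      s_big ≤ (((q : ℚ) + 2 - (1 : ℕ)) / ((q : ℚ) + 2 - c) - ((q : ℚ) + 2) / ((q : ℚ) + 1)) / c)
    (hp₅ : ∀ u : ℕ, 5 ≤ u → u ≤ q + 2 →
      p₅ ≤ (((q : ℚ) + 2 - (1 : ℕ)) / ((q : ℚ) + 3 - u) - ((q : ℚ) + 2) / ((q : ℚ) + 1)) / (u.choose 2 : ℕ))
    (harith2 : 1 / ((q : ℚ) + 1) ≤ s₃ + s_big)
    (harith : 3 ≤ G.card - q →
      1 / ((q : ℚ) + 1) ≤ ((G.card - q : ℕ) : ℚ) * s₃ + (((G.card - q).choose 2 : ℕ) : ℚ) * p₅) :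
    0 ≤ Jq M G q 1 := by
  have hGg : G ⊆ gr M := (mem_flatsQ.1 hG).1
  have hrG : M.eRk (G : Set α) = (q : ℕ∞) := (mem_flatsQ.1 hG).2.2
  apply Jq_nonneg_of_chargeT
  intro B₀ hB
  obtain ⟨hBG, hr, hc⟩ := mem_basesOf.1 hB
  have hkc : (G \ B₀).card = G.card - q := by rw [Finset.card_sdiff_of_subset hBG, hc]
  have hw := wT_one_basis_ge hGg hB
  have hne : B₀.Nonempty := Finset.card_pos.1 (by omega)
  have hc3 : ∀ x ∈ G \ B₀, 3 ≤ (fc M x B₀).card := fun x hx =>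
    three_le_card_fc hs (hBG.trans hGg) (hGg (Finset.mem_sdiff.1 hx).1) (indep_of_mem_basesOf hB)
      (mem_closure_of_mem_basesOf hGg hrG hB (Finset.mem_sdiff.1 hx).1) (Finset.mem_sdiff.1 hx).2 hne
  have hcq : ∀ x ∈ G \ B₀, (fc M x B₀).card ≤ q + 1 := fun x _ => by
    have := card_fc_le (M := M) x B₀
    omega
  have hσ : ∀ x ∈ G \ B₀, s₃ ≤ wT M G (insert x B₀) q 1 / nb M G (insert x B₀) q := fun x hx =>
    single_boundT hs hGg hrG hB hq (by norm_num) hx (hc3 x hx) (hcq x hx) hs₃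
  have hτ : ∀ P ∈ (G \ B₀).powersetCard 2, p₅ ≤ wT M G (B₀ ∪ P) q 1 / nb M G (B₀ ∪ P) q := by
    intro P hP
    refine pair_boundT hs hGg hrG hB hq (by norm_num) hP (u₀ := 5) ?_ hp₅
    intro x hx y hy hxy
    have hPsub := (Finset.mem_powersetCard.1 hP).1
    exact five_le_card_union_fc hs hline hGg hrG hB hq (Finset.mem_sdiff.1 (hPsub hx)).1
      (Finset.mem_sdiff.1 (hPsub hx)).2 (Finset.mem_sdiff.1 (hPsub hy)).1 (Finset.mem_sdiff.1 (hPsub hy)).2 hxy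
  by_cases hk3 : 3 ≤ G.card - q
  · have h := chargeT_ge_of_bounds_fn hs hGg hrG hB hq (by norm_num) (fun _ => s₃) (fun _ => p₅) hσ hτ
    rw [Finset.sum_const, Finset.sum_const, Finset.card_powersetCard, nsmul_eq_mul, nsmul_eq_mul, hkc] at h
    have := harith hk3
    linarith
  · -- `k = 2`: the two circuits cover `B₀`, one of them has `≥ c*` points
    have hk2 : (G \ B₀).card = 2 := by omega
    obtain ⟨x, y, hxy, hxyeq⟩ := Finset.card_eq_two.1 hk2
    have hxK : x ∈ G \ B₀ := by rw [hxyeq]; exact Finset.mem_insert_self x {y}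
    have hyK : y ∈ G \ B₀ := by rw [hxyeq]; exact Finset.mem_insert_of_mem (Finset.mem_singleton_self y)
    have hS := card_le_sum_card_fc hGg hrG hB hfree
    rw [hxyeq, Finset.sum_pair hxy] at hS
    have hbig : c_star ≤ (fc M x B₀).card ∨ c_star ≤ (fc M y B₀).card := by
      by_contra hcon
      push Not at hcon
      have := hc3 x hxK
      have := hc3 y hyK
      omega
    set σ : α → ℚ := fun z => if c_star ≤ (fc M z B₀).card then s_big else s₃ with hσdef
    have hσ' : ∀ z ∈ G \ B₀, σ z ≤ wT M G (insert z B₀) q 1 / nb M G (insert z B₀) q := by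
      intro z hz
      rw [hσdef]
      simp only
      split_ifs with hcz
      · exact single_boundT hs hGg hrG hB hq (by norm_num) hz hcz (hcq z hz) hsbig
      · exact hσ z hz
    have h := chargeT_ge_of_bounds_fn hs hGg hrG hB hq (by norm_num) σ (fun _ => p₅) hσ' hτ
    rw [hxyeq, Finset.sum_pair hxy, Finset.sum_const, Finset.card_powersetCard, Finset.card_pair hxy,
      nsmul_eq_mul] at h
    have hσxy : s₃ + s_big ≤ σ x + σ y := by
      rw [hσdef]
      simp only
      rcases hbig with hbx | hby
      · rw [if_pos hbx]
        split_ifs <;> linarith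
      · rw [if_pos hby]
        split_ifs <;> linarith
    norm_num [Nat.choose] at h
    linarith

/-! ## The six rows -/

/-- **The type-`1` window of level `6`** (`8 ≤ g ≤ 9`). -/
theorem jq_one_nonneg_of_lines_six (hs : Simple M) (hline : ∀ L ∈ flatsQ M 2, L.card ≤ 3) {G : Finset α}
    (hG : G ∈ flatsQ M 6) (hk : 6 + 2 ≤ G.card) (hwin : (G.card - 6) * (6 + 3) + 1 < 6 * 6) : 0 ≤ Jq M G 6 1 := by
  refine jq_one_nonneg_of_tables hs hline (by norm_num) hG (3 / 35) (17 / 280) ?_ ?_ ?_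
  · intro c h0 h1; interval_cases c <;> norm_num
  · intro u h0 h1; interval_cases u <;> norm_num [Nat.choose]
  · have h2 : 2 ≤ G.card - 6 := by omega
    have h3 : G.card - 6 ≤ 3 := by omega
    set k := G.card - 6 with hk'
    interval_cases k <;> norm_num [Nat.choose]

/-- **The type-`1` window of level `7`** (`9 ≤ g ≤ 11`). -/
theorem jq_one_nonneg_of_lines_seven (hs : Simple M) (hline : ∀ L ∈ flatsQ M 2, L.card ≤ 3) {G : Finset α}
    (hG : G ∈ flatsQ M 7) (hk : 7 + 2 ≤ G.card) (hwin : (G.card - 7) * (7 + 3) + 1 < 7 * 7) : 0 ≤ Jq M G 7 1 := by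
  refine jq_one_nonneg_of_tables hs hline (by norm_num) hG (5 / 72) (19 / 400) ?_ ?_ ?_
  · intro c h0 h1; interval_cases c <;> norm_num
  · intro u h0 h1; interval_cases u <;> norm_num [Nat.choose]
  · have h2 : 2 ≤ G.card - 7 := by omega
    have h3 : G.card - 7 ≤ 4 := by omega
    set k := G.card - 7 with hk'
    interval_cases k <;> norm_num [Nat.choose]

/-- **The type-`1` window of level `8`** (`10 ≤ g ≤ 13`). -/
theorem jq_one_nonneg_of_lines_eight (hs : Simple M) (hline : ∀ L ∈ flatsQ M 2, L.card ≤ 3) {G : Finset α}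
    (hG : G ∈ flatsQ M 8) (hk : 8 + 2 ≤ G.card) (hwin : (G.card - 8) * (8 + 3) + 1 < 8 * 8) : 0 ≤ Jq M G 8 1 := by
  refine jq_one_nonneg_of_tables hs hline (by norm_num) hG (11 / 189) (7 / 180) ?_ ?_ ?_
  · intro c h0 h1; interval_cases c <;> norm_num
  · intro u h0 h1; interval_cases u <;> norm_num [Nat.choose]
  · have h2 : 2 ≤ G.card - 8 := by omega
    have h3 : G.card - 8 ≤ 5 := by omega
    set k := G.card - 8 with hk'
    interval_cases k <;> norm_num [Nat.choose]

/-- **The type-`1` window of level `9`** (`11 ≤ g ≤ 15`). -/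
theorem jq_one_nonneg_of_lines_nine (hs : Simple M) (hline : ∀ L ∈ flatsQ M 2, L.card ≤ 3) {G : Finset α}
    (hG : G ∈ flatsQ M 9) (hk : 9 + 2 ≤ G.card) (hwin : (G.card - 9) * (9 + 3) + 1 < 9 * 9) : 0 ≤ Jq M G 9 1 := by
  refine jq_one_nonneg_of_tables hs hline (by norm_num) hG (1 / 20) (23 / 700) ?_ ?_ ?_
  · intro c h0 h1; interval_cases c <;> norm_num
  · intro u h0 h1; interval_cases u <;> norm_num [Nat.choose]
  · have h2 : 2 ≤ G.card - 9 := by omega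
    have h3 : G.card - 9 ≤ 6 := by omega
    set k := G.card - 9 with hk'
    interval_cases k <;> norm_num [Nat.choose]

/-- **The type-`1` window of level `10`** (`12 ≤ g ≤ 17`, coloop-free). -/
theorem jq_one_nonneg_of_lines_ten (hs : Simple M) (hline : ∀ L ∈ flatsQ M 2, L.card ≤ 3) {G : Finset α}
    (hG : G ∈ flatsQ M 10) (hfree : mTr M G = 0) (hk : 10 + 2 ≤ G.card)
    (hwin : (G.card - 10) * (10 + 3) + 1 < 10 * 10) : 0 ≤ Jq M G 10 1 := by
  refine jq_one_nonneg_of_tables_cover hs hline (by norm_num) hG hfree hk (13 / 297) (5 / 176) (49 / 396) 6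
    (by norm_num) (by norm_num) (by norm_num) ?_ ?_ ?_ (by norm_num) ?_
  · intro c h0 h1; interval_cases c <;> norm_num
  · intro c h0 h1; interval_cases c <;> norm_num
  · intro u h0 h1; interval_cases u <;> norm_num [Nat.choose]
  · intro h3
    have h7 : G.card - 10 ≤ 7 := by omega
    set k := G.card - 10 with hk'
    interval_cases k <;> norm_num [Nat.choose]

/-- **The type-`1` window of level `11`** (`13 ≤ g ≤ 19`, coloop-free). -/
theorem jq_one_nonneg_of_lines_eleven (hs : Simple M) (hline : ∀ L ∈ flatsQ M 2, L.card ≤ 3) {G : Finset α}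
    (hG : G ∈ flatsQ M 11) (hfree : mTr M G = 0) (hk : 11 + 2 ≤ G.card)
    (hwin : (G.card - 11) * (11 + 3) + 1 < 11 * 11) : 0 ≤ Jq M G 11 1 := by
  refine jq_one_nonneg_of_tables_cover hs hline (by norm_num) hG hfree hk (7 / 180) (1 / 40) (11 / 84) 7
    (by norm_num) (by norm_num) (by norm_num) ?_ ?_ ?_ (by norm_num) ?_
  · intro c h0 h1; interval_cases c <;> norm_num
  · intro c h0 h1; interval_cases c <;> norm_num
  · intro u h0 h1; interval_cases u <;> norm_num [Nat.choose]
  · intro h3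
    have h8 : G.card - 11 ≤ 8 := by omega
    set k := G.card - 11 with hk'
    interval_cases k <;> norm_num [Nat.choose]

/-- **THE `t = 1` WINDOW OF `OpenLayersCoreFree q` IS A THEOREM FOR EVERY `6 ≤ q ≤ 11`** (for `q = 5` the clause is
vacuous): on every Core matroid, every coloop-free rank-`q` flat with `q + 2 ≤ g` and `(g − q)(q + 3) + 1 < q²`
satisfies the type-`1` balance. -/
theorem jq_one_nonneg_of_core {γ : Type} [DecidableEq γ] {M : Matroid γ} [M.Finite] {p q : ℕ} (hc : Core M p)
    (h6 : 6 ≤ q) (hq' : q ≤ 11) {G : Finset γ} (hG : G ∈ flatsQ M q) (hfree : mTr M G = 0)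
    (hk : q + 2 ≤ G.card) (hwin : (G.card - q) * (q + 3) + 1 < q * q) : 0 ≤ Jq M G q 1 := by
  have hs := simple_of_core hc
  have hline : ∀ L ∈ flatsQ M 2, L.card ≤ 3 := fun _ hL => card_le_three_of_line_of_core hc hL
  interval_cases q
  · exact jq_one_nonneg_of_lines_six hs hline hG hk hwin
  · exact jq_one_nonneg_of_lines_seven hs hline hG hk hwin
  · exact jq_one_nonneg_of_lines_eight hs hline hG hk hwin
  · exact jq_one_nonneg_of_lines_nine hs hline hG hk hwin
  · exact jq_one_nonneg_of_lines_ten hs hline hG hfree hk hwin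
  · exact jq_one_nonneg_of_lines_eleven hs hline hG hfree hk hwin

end PercRepro.GenQ
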